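import Summits.Ventures.HodgeKum4.Theses.KummerFixedLocus
import HarnessLib

/-!
# Route item `Assembly` of `KummerFixedLocus` — OUTRIGHT closer (cell `hodge-kum4`, seat p2)

HONEST FRAMING.  The assembly item of route `KummerFixedLocus` is the implication
`L1 → L3° → L2 → F_Γ → F_Γ′ → HC_Kum4Type`; it is a THEOREM of the tree (finite-group averaging,
`Summit.Ventures.HodgeKum4.hc_kum4Type_of_inputs`, module `Summits/Ventures/HodgeKum4/Statement`),
so the item closes unconditionally.  This proves NOTHING about the five nodes themselves (L1, L3°, L2
are open; F_Γ, F_Γ′ are print inputs) and nothing about `HC_Kum4Type`.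
-/

namespace Summit.Ventures.HodgeKum4

/-- **The assembly of route `KummerFixedLocus` holds outright**: `LefschetzGenerationKum4 →
Kum4NonInvariantClassesAlgebraic → MotivicBookkeepingKum4 → Kum4TranslationGroup →
Kum4TranslationGroupTrivialOffMiddle → HC_Kum4Type`, by the kernel averaging theorem
`hc_kum4Type_of_inputs` (argument order `L1, L2, F_Γ, F_Γ′, L3°`). -/
theorem assembly_proof : Summit.Ventures.HodgeKum4.Theses.KummerFixedLocus.Assembly := by
  unfold Summit.Ventures.HodgeKum4.Theses.KummerFixedLocus.Assembly
    Summit.Ventures.HodgeKum4.Theses.KummerFixedLocus.LefschetzGenerationKum4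
    Summit.Ventures.HodgeKum4.Theses.KummerFixedLocus.Kum4NonInvariantClassesAlgebraic
    Summit.Ventures.HodgeKum4.Theses.KummerFixedLocus.MotivicBookkeepingKum4
    Summit.Ventures.HodgeKum4.Theses.KummerFixedLocus.Kum4TranslationGroup
    Summit.Ventures.HodgeKum4.Theses.KummerFixedLocus.Kum4TranslationGroupTrivialOffMiddle
  exact fun h₁ h₃ h₂ hΓ hoff => hc_kum4Type_of_inputs h₁ h₂ hΓ hoff h₃

end Summit.Ventures.HodgeKum4
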